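import Literature.NumberTheory.GaloisRepresentations.GlobalArtinMapAbstractExtensionProofs
import Literature.NumberTheory.GaloisRepresentations.GlobalNormGroupLatticeProofs
import Literature.NumberTheory.GaloisRepresentations.IdelicLocalNorm
import Literature.NumberTheory.Automorphic.NormGroupClosedProofs
import HarnessLib

/-!
# Conjugates of class fields: `N(ρ L) = ρ|_{K'} · N(L)`, and Galois-stable norm groups have class
# fields normal over the ground field (Tate, Cassels–Fröhlich VII §12, Lemma: "M/K is Galois since
# H' is invariant under G(L/K)")

Topic `NumberTheory/GaloisRepresentations` (global class field theory); namespace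
`Literature.NumberTheory.GaloisRepresentations`.  Proof file with auxiliary definitions
(`semilinearConj`, `semilinearConjHom`, `conjField`, `conjFieldEquiv`) and instances on the file's own
`conjField`; no named fact (D-0026).

Setting: `K ⊆ K'` fields with `K'|K` finite Galois, `K'` a number field, `Ω = K̄' = AlgebraicClosure K'` (an
algebraic closure of `K'`, hence a normal extension of `K`), `L ⊆ Ω` a finite abelian extension of
`K'`, and `ρ ∈ Aut_K(Ω)` with restriction `σ = ρ|_{K'} ∈ G(K'|K)`.  The conjugate field `ρ L ⊆ Ω` contains
`ρ K' = K'` and is again finite abelian over `K'`; `ρ : L → ρ L` is a `σ`-semilinear ring isomorphism.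

* `semilinearConj e σ` — for a `σ`-semilinear ring isomorphism `e : M₀ ≃ M₂` of `K'`-algebras,
  `a ↦ e a e⁻¹ : G(M₀|K') → G(M₂|K')` (a group isomorphism; `M₂` has abelian group if `M₀` has);
  `isArithFrobAt_semilinearConj` — it carries a Frobenius at `𝔔 ∣ w` to a Frobenius at `e 𝔔 ∣ σ w`.
* `conjField ρ L = ρ L` with `conjFieldEquiv ρ L : L ≃+* ρ L`, instances (finite, number field,
  abelian Galois over `K'`).
* **`artinIdeleMap_conjField`** (Tate VII 11.5, transport of structure of the Artin map):
  `ψ_{ρL|K'}(σ • x) = ρ ψ_{L|K'}(x) ρ⁻¹`, by uniqueness of the Artin map; hence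
  **`normGroup_conjField : K'ˣ N_{ρL|K'} 𝕀_{ρL} = σ • (K'ˣ N_{L|K'} 𝕀_L)`**.
* **`conjField_eq_of_smul_normGroup_eq`**: if `σ • N_L = N_L` then `ρ L = L` (uniqueness of the class
  field, `IsGlobalReciprocitySystem.eq_of_normClassGroup_eq`), and
  **`normal_of_forall_smul_normGroup_eq`**: *if the norm group of `L|K'` is `G(K'|K)`-stable, then
  `L|K` is normal* — the step "M/K is a Galois extension since H' is invariant under G(L/K)" of
  Tate's Lemma in §12 (PDF p. 239).

## References

* J. Tate, *Global class field theory*, Ch. VII in J. W. S. Cassels, A. Fröhlich (eds.), *Algebraic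
  Number Theory*, Academic Press 1967, Thm. 11.5, §12 Lemma (PDF pp. 236, 239). [CasselsFrohlichANT1967]
* J. Neukirch, *Class Field Theory — The Bonn Lectures*, ed. A. Schmidt, Springer 2013, Part III
  (6.14). [Neukirch2013]
* J. Neukirch, *Algebraic Number Theory*, Grundlehren 322, Springer 1999, Ch. I §9. [NeukirchANT1999]
-/

noncomputable section

open scoped NumberField Pointwise
open NumberField IsDedekindDomain IsDedekindDomain.HeightOneSpectrum Filter
open Literature.NumberTheory.Automorphic

namespace Literature.NumberTheory.GaloisRepresentations

/-! ### Semilinear conjugation of Galois groups -/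

section SemilinearConj

variable {K : Type*} [Field K] {K' : Type*} [Field K'] [Algebra K K']
  {M₀ : Type*} [Field M₀] [Algebra K' M₀] {M₂ : Type*} [Field M₂] [Algebra K' M₂]
  (e : M₀ ≃+* M₂) (σ : K' ≃ₐ[K] K') (he : ∀ c : K', e (algebraMap K' M₀ c) = algebraMap K' M₂ (σ c))

include he in
/-- `e⁻¹` is `σ⁻¹`-semilinear. [folklore] -/
theorem symm_algebraMap_of_semilinear (c : K') :
    e.symm (algebraMap K' M₂ c) = algebraMap K' M₀ (σ.symm c) := by
  apply e.injective
  rw [e.apply_symm_apply, he, AlgEquiv.apply_symm_apply]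

/-- **`a ↦ e a e⁻¹ : G(M₀|K') → G(M₂|K')`** for a `σ`-semilinear ring isomorphism `e : M₀ ≃ M₂`
(`e a e⁻¹` is `K'`-linear as `σ σ⁻¹ = 1`). [folklore] -/
def semilinearConj (a : M₀ ≃ₐ[K'] M₀) : M₂ ≃ₐ[K'] M₂ :=
  { (e.symm.trans (a.toRingEquiv.trans e)) with
    commutes' := fun c => by
      change e (a (e.symm (algebraMap K' M₂ c))) = algebraMap K' M₂ c
      rw [symm_algebraMap_of_semilinear e σ he, a.commutes, he, AlgEquiv.apply_symm_apply] }

/-- `(e a e⁻¹) m = e (a (e⁻¹ m))`. [folklore] -/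
@[simp] theorem semilinearConj_apply (a : M₀ ≃ₐ[K'] M₀) (m : M₂) :
    semilinearConj e σ he a m = e (a (e.symm m)) := rfl

/-- `semilinearConj` is multiplicative. [folklore] -/
theorem semilinearConj_mul (a b : M₀ ≃ₐ[K'] M₀) :
    semilinearConj e σ he (a * b) = semilinearConj e σ he a * semilinearConj e σ he b :=
  AlgEquiv.ext fun m => by simp only [AlgEquiv.mul_apply, semilinearConj_apply, e.symm_apply_apply]

/-- `semilinearConj 1 = 1`. [folklore] -/
@[simp] theorem semilinearConj_one : semilinearConj e σ he (1 : M₀ ≃ₐ[K'] M₀) = 1 :=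
  AlgEquiv.ext fun m => by simp

/-- **`semilinearConj` as a group homomorphism.** [folklore] -/
def semilinearConjHom : (M₀ ≃ₐ[K'] M₀) →* (M₂ ≃ₐ[K'] M₂) where
  toFun := semilinearConj e σ he
  map_one' := semilinearConj_one e σ he
  map_mul' := semilinearConj_mul e σ he

/-- Unfolding lemma. [folklore] -/
@[simp] theorem semilinearConjHom_apply (a : M₀ ≃ₐ[K'] M₀) :
    semilinearConjHom e σ he a = semilinearConj e σ he a := rfl

/-- `e a e⁻¹ = 1 ↔ a = 1`. [folklore] -/
theorem semilinearConj_eq_one_iff (a : M₀ ≃ₐ[K'] M₀) : semilinearConj e σ he a = 1 ↔ a = 1 := by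
  refine ⟨fun h => AlgEquiv.ext fun m => ?_, fun h => by rw [h, semilinearConj_one]⟩
  have hm := DFunLike.congr_fun h (e m)
  rw [semilinearConj_apply, e.symm_apply_apply, AlgEquiv.one_apply] at hm
  exact e.injective hm

/-- `semilinearConj e` is surjective (its inverse is `semilinearConj e⁻¹`). [folklore] -/
theorem semilinearConj_surjective : Function.Surjective (semilinearConj e σ he) := fun b =>
  ⟨semilinearConj e.symm σ.symm (symm_algebraMap_of_semilinear e σ he) b, AlgEquiv.ext fun m => by simp⟩

include he in
/-- **If `G(M₀|K')` is commutative, so is `G(M₂|K')`.** [folklore] -/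
theorem commute_of_semilinearConj [IsMulCommutative (M₀ ≃ₐ[K'] M₀)] (a b : M₂ ≃ₐ[K'] M₂) :
    a * b = b * a := by
  obtain ⟨a₀, rfl⟩ := semilinearConj_surjective e σ he a
  obtain ⟨b₀, rfl⟩ := semilinearConj_surjective e σ he b
  rw [← semilinearConj_mul, ← semilinearConj_mul, IsMulCommutative.is_comm.comm a₀ b₀]

end SemilinearConj

/-! ### Frobenius elements along a semilinear isomorphism of number fields -/

section Frobenius

variable {K : Type*} [Field K] {K' : Type*} [Field K'] [NumberField K'] [Algebra K K']
  {M₀ : Type*} [Field M₀] [NumberField M₀] [Algebra K' M₀]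
  {M₂ : Type*} [Field M₂] [NumberField M₂] [Algebra K' M₂]
  (e : M₀ ≃+* M₂) (σ : K' ≃ₐ[K] K') (he : ∀ c : K', e (algebraMap K' M₀ c) = algebraMap K' M₂ (σ c))

omit [NumberField K'] [NumberField M₀] [NumberField M₂] in
include he in
/-- On rings of integers, `e⁻¹ (c) = σ⁻¹ c` for `c ∈ 𝓞 K'`. [folklore] -/
theorem mapRingEquiv_symm_algebraMap (x : 𝓞 K') :
    (RingOfIntegers.mapRingEquiv e).symm (algebraMap (𝓞 K') (𝓞 M₂) x) =
      algebraMap (𝓞 K') (𝓞 M₀) (σ⁻¹ • x) := by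
  apply RingOfIntegers.ext
  change e.symm (algebraMap K' M₂ (x : K')) = algebraMap K' M₀ ((σ⁻¹ • x : 𝓞 K') : K')
  rw [symm_algebraMap_of_semilinear e σ he, RingOfIntegers.coe_algEquiv_smul]
  rfl

omit [NumberField K'] [NumberField M₀] [NumberField M₂] in
include he in
/-- **Conjugate primes along `e`**: if `𝔔 ∣ w` in `M₀|K'` then `e 𝔔 ∣ σ w` in `M₂|K'` (we write
`e 𝔔` as the preimage of `𝔔` under `e⁻¹`). [cite: NeukirchANT1999, Ch. I §9] -/
theorem comap_symm_mem_primesOver_smul {w : HeightOneSpectrum (𝓞 K')} {Q : Ideal (𝓞 M₀)}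
    (hQ : Q ∈ w.asIdeal.primesOver (𝓞 M₀)) :
    Q.comap (RingOfIntegers.mapRingEquiv e).symm ∈ (σ • w).asIdeal.primesOver (𝓞 M₂) := by
  obtain ⟨hprime, hover⟩ := hQ
  haveI := hprime
  refine ⟨Ideal.comap_isPrime _ _, ⟨?_⟩⟩
  ext x
  have hw : w.asIdeal = Q.under (𝓞 K') := hover.over
  simp only [HeightOneSpectrum.smul_asIdeal, Ideal.mem_pointwise_smul_iff_inv_smul_mem,
    Ideal.under_def, Ideal.mem_comap, mapRingEquiv_symm_algebraMap e σ he]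
  rw [hw, Ideal.under_def, Ideal.mem_comap]

omit [NumberField K'] [NumberField M₀] [NumberField M₂] in
/-- On rings of integers, `e a e⁻¹` acts by `y ↦ e (a (e⁻¹ y))`. [folklore] -/
theorem mapRingEquiv_symm_semilinearConj_smul (a : M₀ ≃ₐ[K'] M₀) (y : 𝓞 M₂) :
    (RingOfIntegers.mapRingEquiv e).symm (semilinearConj e σ he a • y) =
      a • (RingOfIntegers.mapRingEquiv e).symm y :=
  RingOfIntegers.ext (by
    change e.symm (e (a (e.symm (y : M₂)))) = a (e.symm (y : M₂))
    rw [e.symm_apply_apply])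

omit [NumberField K'] [NumberField M₀] [NumberField M₂] in
/-- **Frobenius elements along `e`**: if `φ` is an arithmetic Frobenius of `M₀|K'` at `𝔔 ∣ w`, then
`e φ e⁻¹` is an arithmetic Frobenius of `M₂|K'` at `e 𝔔 ∣ σ w`. [cite: NeukirchANT1999, Ch. I §9] -/
theorem isArithFrobAt_semilinearConj {w : HeightOneSpectrum (𝓞 K')} {Q : Ideal (𝓞 M₀)}
    (hQ : Q ∈ w.asIdeal.primesOver (𝓞 M₀)) {φ : M₀ ≃ₐ[K'] M₀} (hφ : IsArithFrobAt (𝓞 K') φ Q) :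
    IsArithFrobAt (𝓞 K') (semilinearConj e σ he φ)
      (Q.comap (RingOfIntegers.mapRingEquiv e).symm) := by
  have hunder : (Q.comap (RingOfIntegers.mapRingEquiv e).symm).under (𝓞 K') = (σ • w).asIdeal :=
    ((comap_symm_mem_primesOver_smul e σ he hQ).2.over).symm
  have hunder₀ : Q.under (𝓞 K') = w.asIdeal := (hQ.2.over).symm
  intro y
  rw [MulSemiringAction.toAlgHom_apply, hunder, HeightOneSpectrum.card_quotient_smul, Ideal.mem_comap,
    map_sub, map_pow, mapRingEquiv_symm_semilinearConj_smul]
  have h := hφ ((RingOfIntegers.mapRingEquiv e).symm y)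
  rwa [MulSemiringAction.toAlgHom_apply, hunder₀] at h

end Frobenius

/-! ### The conjugate `ρ L` of a class field `L ⊆ K̄'` under `ρ ∈ Aut_K(K̄')` -/

section ConjField

variable {K : Type} [Field K] {K' : Type} [Field K'] [Algebra K K'] [IsGalois K K']

/-- `ρ⁻¹` on `K' ⊆ K̄'` is `(ρ|_{K'})⁻¹`. [folklore] -/
theorem algClosure_symm_algebraMap (ρ : (AlgebraicClosure K') ≃ₐ[K] (AlgebraicClosure K')) (c : K') :
    ρ.symm (algebraMap K' (AlgebraicClosure K') c) = algebraMap K' (AlgebraicClosure K') ((ρ.restrictNormal K').symm c) := by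
  apply ρ.injective
  rw [AlgEquiv.apply_symm_apply, ← AlgEquiv.restrictNormal_commutes (χ := ρ) (E := K'),
    AlgEquiv.apply_symm_apply]

/-- **The conjugate field `ρ L ⊆ K̄'`** of `L ⊆ K̄'` under `ρ ∈ Aut_K(K̄')`, as an extension of `K'`
(it contains `ρ K' = K'`). [folklore] -/
def conjField (ρ : (AlgebraicClosure K') ≃ₐ[K] (AlgebraicClosure K')) (L : IntermediateField K' (AlgebraicClosure K')) : IntermediateField K' (AlgebraicClosure K') :=
  { ((L.restrictScalars K).map (ρ : (AlgebraicClosure K') →ₐ[K] (AlgebraicClosure K'))).toSubfield with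
    algebraMap_mem' := fun c => by
      change algebraMap K' (AlgebraicClosure K') c ∈ (L.restrictScalars K).map (ρ : (AlgebraicClosure K') →ₐ[K] (AlgebraicClosure K'))
      rw [IntermediateField.mem_map]
      refine ⟨algebraMap K' (AlgebraicClosure K') ((ρ.restrictNormal K').symm c), ?_, ?_⟩
      · rw [IntermediateField.mem_restrictScalars]
        exact L.algebraMap_mem _
      · change ρ (algebraMap K' (AlgebraicClosure K') ((ρ.restrictNormal K').symm c)) = algebraMap K' (AlgebraicClosure K') c
        rw [← AlgEquiv.restrictNormal_commutes (χ := ρ) (E := K'), AlgEquiv.apply_symm_apply] }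

/-- `x ∈ ρ L ↔ x = ρ y` for some `y ∈ L`. [folklore] -/
theorem mem_conjField_iff {ρ : (AlgebraicClosure K') ≃ₐ[K] (AlgebraicClosure K')} {L : IntermediateField K' (AlgebraicClosure K')} {x : (AlgebraicClosure K')} :
    x ∈ conjField ρ L ↔ ∃ y ∈ L, ρ y = x := by
  change x ∈ (L.restrictScalars K).map (ρ : (AlgebraicClosure K') →ₐ[K] (AlgebraicClosure K')) ↔ _
  rw [IntermediateField.mem_map]
  rfl

/-- **`ρ : L ≃ ρ L`** as a ring isomorphism (it is `ρ|_{K'}`-semilinear over `K'`). [folklore] -/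
def conjFieldEquiv (ρ : (AlgebraicClosure K') ≃ₐ[K] (AlgebraicClosure K')) (L : IntermediateField K' (AlgebraicClosure K')) : L ≃+* conjField ρ L where
  toFun y := ⟨ρ y, mem_conjField_iff.mpr ⟨y, y.2, rfl⟩⟩
  invFun x := ⟨ρ.symm x, by
    obtain ⟨y, hy, hyx⟩ := mem_conjField_iff.mp x.2
    rw [← hyx, AlgEquiv.symm_apply_apply]
    exact hy⟩
  left_inv y := Subtype.ext (ρ.symm_apply_apply _)
  right_inv x := Subtype.ext (ρ.apply_symm_apply _)
  map_mul' y z := Subtype.ext (map_mul ρ _ _)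
  map_add' y z := Subtype.ext (map_add ρ _ _)

/-- `(ρ y : K̄') = ρ y`. [folklore] -/
@[simp] theorem coe_conjFieldEquiv_apply (ρ : (AlgebraicClosure K') ≃ₐ[K] (AlgebraicClosure K')) (L : IntermediateField K' (AlgebraicClosure K')) (y : L) :
    ((conjFieldEquiv ρ L y : conjField ρ L) : (AlgebraicClosure K')) = ρ y := rfl

/-- **`ρ` is `ρ|_{K'}`-semilinear**: `ρ (c y) = (ρ|_{K'} c) (ρ y)`. [folklore] -/
theorem conjFieldEquiv_semilinear (ρ : (AlgebraicClosure K') ≃ₐ[K] (AlgebraicClosure K')) (L : IntermediateField K' (AlgebraicClosure K')) (c : K') :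
    conjFieldEquiv ρ L (algebraMap K' L c) = algebraMap K' (conjField ρ L) (ρ.restrictNormal K' c) :=
  Subtype.ext (by
    change ρ (algebraMap K' (AlgebraicClosure K') c) = algebraMap K' (AlgebraicClosure K') (ρ.restrictNormal K' c)
    exact (AlgEquiv.restrictNormal_commutes (χ := ρ) (E := K') c).symm)

/-- `ρ L` is stable under `Aut_{K'}(K̄')` if `L` is normal over `K'`. [folklore] -/
theorem conjField_map_le (ρ : (AlgebraicClosure K') ≃ₐ[K] (AlgebraicClosure K')) (L : IntermediateField K' (AlgebraicClosure K')) [Normal K' L]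
    (θ : (AlgebraicClosure K') ≃ₐ[K'] (AlgebraicClosure K')) : (conjField ρ L).map (θ : (AlgebraicClosure K') →ₐ[K'] (AlgebraicClosure K')) ≤ conjField ρ L := by
  intro x hx
  rw [IntermediateField.mem_map] at hx
  obtain ⟨z, hz, rfl⟩ := hx
  obtain ⟨y, hy, rfl⟩ := mem_conjField_iff.mp hz
  -- `θ' = ρ⁻¹ θ ρ` is `K'`-linear, so it preserves the normal `L`
  let θK : (AlgebraicClosure K') ≃ₐ[K] (AlgebraicClosure K') := ρ.trans ((θ.restrictScalars K).trans ρ.symm)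
  have hθK : ∀ c : K', θK (algebraMap K' (AlgebraicClosure K') c) = algebraMap K' (AlgebraicClosure K') c := fun c => by
    change ρ.symm (θ (ρ (algebraMap K' (AlgebraicClosure K') c))) = algebraMap K' (AlgebraicClosure K') c
    rw [← AlgEquiv.restrictNormal_commutes (χ := ρ) (E := K'), θ.commutes, algClosure_symm_algebraMap,
      AlgEquiv.symm_apply_apply]
  let θ' : (AlgebraicClosure K') ≃ₐ[K'] (AlgebraicClosure K') := { θK with commutes' := hθK }
  have hyθ : θ' y ∈ L :=
    (IntermediateField.normal_iff_forall_map_le'.mp inferInstance θ')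
      (by rw [IntermediateField.mem_map]; exact ⟨y, hy, rfl⟩)
  refine mem_conjField_iff.mpr ⟨θ' y, hyθ, ?_⟩
  change ρ (ρ.symm (θ (ρ y))) = θ (ρ y)
  rw [AlgEquiv.apply_symm_apply]

/-- `ρ L` is normal over `K'` if `L` is. [folklore] -/
theorem normal_conjField (ρ : (AlgebraicClosure K') ≃ₐ[K] (AlgebraicClosure K')) (L : IntermediateField K' (AlgebraicClosure K')) [Normal K' L] :
    Normal K' (conjField ρ L) :=
  IntermediateField.normal_iff_forall_map_le'.mpr (conjField_map_le ρ L)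

variable [NumberField K'] [FiniteDimensional K K']

/-- `ρ L` is finite over `K'`. [folklore] -/
instance finiteDimensional_conjField (ρ : (AlgebraicClosure K') ≃ₐ[K] (AlgebraicClosure K')) (L : IntermediateField K' (AlgebraicClosure K'))
    [FiniteDimensional K' L] : FiniteDimensional K' (conjField ρ L) := by
  haveI : FiniteDimensional K L := Module.Finite.trans K' L
  let f : L ≃ₗ[K] conjField ρ L :=
    { conjFieldEquiv ρ L with
      map_smul' := fun k y => Subtype.ext (by
        change ρ (k • (y : (AlgebraicClosure K'))) = k • ρ (y : (AlgebraicClosure K'))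
        rw [Algebra.smul_def, Algebra.smul_def, map_mul, AlgEquiv.commutes]) }
  haveI : FiniteDimensional K (conjField ρ L) := LinearEquiv.finiteDimensional f
  exact Module.Finite.of_restrictScalars_finite K K' _

/-- `ρ L` is a number field. [folklore] -/
instance numberField_conjField (ρ : (AlgebraicClosure K') ≃ₐ[K] (AlgebraicClosure K')) (L : IntermediateField K' (AlgebraicClosure K')) [FiniteDimensional K' L] :
    NumberField (conjField ρ L) :=
  NumberField.of_module_finite K' _

/-- `ρ L` is abelian over `K'` if `L` is. [folklore] -/
instance isAbelianGalois_conjField (ρ : (AlgebraicClosure K') ≃ₐ[K] (AlgebraicClosure K')) (L : IntermediateField K' (AlgebraicClosure K')) [FiniteDimensional K' L]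
    [IsAbelianGalois K' L] : IsAbelianGalois K' (conjField ρ L) := by
  haveI : Normal K' (conjField ρ L) := normal_conjField ρ L
  haveI : IsGalois K' (conjField ρ L) := IsGalois.mk
  haveI : IsMulCommutative (conjField ρ L ≃ₐ[K'] conjField ρ L) :=
    ⟨⟨commute_of_semilinearConj (conjFieldEquiv ρ L) (ρ.restrictNormal K')
      (conjFieldEquiv_semilinear ρ L)⟩⟩
  exact IsAbelianGalois.mk

/-! ### The Artin map and the norm group of `ρ L` -/

variable (L : IntermediateField K' (AlgebraicClosure K')) [FiniteDimensional K' L] [NumberField L]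
  [IsAbelianGalois K' L]

/-- **Transport of the Artin map (Tate VII 11.5)**: for `ρ ∈ Aut_K(K̄')` with `σ = ρ|_{K'}`,
`ψ_{ρL|K'}(y) = ρ ψ_{L|K'}(σ⁻¹ • y) ρ⁻¹`; proof by uniqueness of the Artin map: the right side has open
kernel, kills `K'ˣ` and takes `⟨ϖ⟩_w ↦ ρ Frob_{σ⁻¹ w}(L) ρ⁻¹ = Frob_w(ρ L)` for almost all `w`.
[cite: CasselsFrohlichANT1967, Ch. VII Thm. 11.5 (PDF p. 236)] -/
theorem artinIdeleMap_conjField (hR : artinReciprocity_character) (ρ : (AlgebraicClosure K') ≃ₐ[K] (AlgebraicClosure K')) (y : ideleGroup K') :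
    artinIdeleMap (conjField ρ L) hR y =
      semilinearConj (conjFieldEquiv ρ L) (ρ.restrictNormal K') (conjFieldEquiv_semilinear ρ L)
        (artinIdeleMap L hR ((ρ.restrictNormal K')⁻¹ • y)) := by
  set σ : K' ≃ₐ[K] K' := ρ.restrictNormal K' with hσ
  set e := conjFieldEquiv ρ L with he_def
  have he : ∀ c : K', e (algebraMap K' L c) = algebraMap K' (conjField ρ L) (σ c) :=
    conjFieldEquiv_semilinear ρ L
  set ψ := artinIdeleMap L hR with hψ
  let f : ideleGroup K' →* (conjField ρ L ≃ₐ[K'] conjField ρ L) :=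
    (semilinearConjHom e σ he).comp (ψ.comp (MulDistribMulAction.toMonoidHom (ideleGroup K') σ⁻¹))
  have hf_apply : ∀ z, f z = semilinearConj e σ he (ψ (σ⁻¹ • z)) := fun z => rfl
  have hf : f = artinIdeleMap (conjField ρ L) hR := by
    refine artinIdeleMap_unique (conjField ρ L) hR f ?_ ?_ ?_
    · have hker : (f.ker : Set (ideleGroup K')) = (fun z => σ⁻¹ • z) ⁻¹' (ψ.ker : Set (ideleGroup K')) := by
        ext z
        simp only [SetLike.mem_coe, MonoidHom.mem_ker, Set.mem_preimage, hf_apply,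
          semilinearConj_eq_one_iff]
      rw [hker]
      exact (isOpen_ker_artinIdeleMap L hR).preimage (ideleGroup_continuous_smul K K' σ⁻¹)
    · intro z hz
      rw [hf_apply, semilinearConj_eq_one_iff]
      exact (MonoidHom.mem_ker).mp
        (principalIdeles_le_ker_artinIdeleMap L hR (smul_mem_principalIdeles K K' σ⁻¹ hz))
    · have h1 : ∀ᶠ w : HeightOneSpectrum (𝓞 K') in cofinite,
          Algebra.IsUnramifiedIn (𝓞 (conjField ρ L)) w.asIdeal := by
        rw [eventually_cofinite]
        exact finite_setOf_not_isUnramifiedIn K' (conjField ρ L)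
      have h2 : ∀ᶠ w : HeightOneSpectrum (𝓞 K') in cofinite,
          Algebra.IsUnramifiedIn (𝓞 L) (σ⁻¹ • w).asIdeal :=
        (MulAction.injective (β := HeightOneSpectrum (𝓞 K')) σ⁻¹).tendsto_cofinite.eventually (by
          rw [eventually_cofinite]
          exact finite_setOf_not_isUnramifiedIn K' L)
      filter_upwards [h1, h2] with w hw hσw
      rw [hf_apply, algEquiv_smul_localUnits K K' σ⁻¹ w,
        artinIdeleMap_localUnits_of_valuation_eq L hR hσw
          (by rw [valued_galAdicCompletionUnitsEquiv]; exact HeckeCharacter.valued_uniformizer (K := K') (v := w))]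
      -- `e Frob_{σ⁻¹ w}(L) e⁻¹ = Frob_w(ρ L)`
      obtain ⟨Q, hQ, hφ⟩ := galFrob_spec K' L (σ⁻¹ • w)
      have hQ' := comap_symm_mem_primesOver_smul e σ he hQ
      have hφ' := isArithFrobAt_semilinearConj e σ he hQ hφ
      rw [smul_inv_smul] at hQ'
      exact eq_galFrob (commute_of_isAbelianGalois (conjField ρ L)) hw hQ' hφ'
  exact (DFunLike.congr_fun hf y).symm

/-- **`ψ_{ρL|K'}(σ • x) = ρ ψ_{L|K'}(x) ρ⁻¹`** (`σ = ρ|_{K'}`).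
[cite: CasselsFrohlichANT1967, Ch. VII Thm. 11.5 (PDF p. 236)] -/
theorem artinIdeleMap_conjField_smul (hR : artinReciprocity_character) (ρ : (AlgebraicClosure K') ≃ₐ[K] (AlgebraicClosure K'))
    (x : ideleGroup K') :
    artinIdeleMap (conjField ρ L) hR (ρ.restrictNormal K' • x) =
      semilinearConj (conjFieldEquiv ρ L) (ρ.restrictNormal K') (conjFieldEquiv_semilinear ρ L)
        (artinIdeleMap L hR x) := by
  rw [artinIdeleMap_conjField L hR ρ, inv_smul_smul]

/-- **The norm group of the conjugate class field: `K'ˣ N_{ρL|K'} 𝕀_{ρL} = σ • (K'ˣ N_{L|K'} 𝕀_L)`.**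
[cite: CasselsFrohlichANT1967, Ch. VII §12, proof of the Lemma (PDF p. 239)] -/
theorem normGroup_conjField (hR : artinReciprocity_character) (ρ : (AlgebraicClosure K') ≃ₐ[K] (AlgebraicClosure K')) :
    Automorphic.normGroup K' (conjField ρ L) = (ρ.restrictNormal K') • Automorphic.normGroup K' L := by
  rw [← ker_artinIdeleMap_eq_normGroup_of_character K' hR (conjField ρ L),
    ← ker_artinIdeleMap_eq_normGroup_of_character K' hR L]
  ext y
  rw [MonoidHom.mem_ker, Subgroup.mem_pointwise_smul_iff_inv_smul_mem, MonoidHom.mem_ker,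
    artinIdeleMap_conjField L hR ρ, semilinearConj_eq_one_iff]

/-- **A class field with `σ`-stable norm group is `ρ`-stable**: if `σ • N_L = N_L` for `σ = ρ|_{K'}`
then `ρ L = L` (uniqueness of the class field of a norm group, Neukirch III (6.14)).
[cite: Neukirch2013, Part III (6.14)] [cite: CasselsFrohlichANT1967, Ch. VII §12 (PDF p. 239)] -/
theorem conjField_eq_of_smul_normGroup_eq (hR : artinReciprocity_character) (ρ : (AlgebraicClosure K') ≃ₐ[K] (AlgebraicClosure K'))
    (h : (ρ.restrictNormal K') • Automorphic.normGroup K' L = Automorphic.normGroup K' L) :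
    conjField ρ L = L := by
  have hN : Automorphic.normGroup K' (conjField ρ L) = Automorphic.normGroup K' L := by
    rw [normGroup_conjField L hR, h]
  exact (isGlobalReciprocitySystem_artinMapFamily' (K := K') hR).eq_of_normClassGroup_eq
    (congrArg (fun N : Subgroup (ideleGroup K') => N.map (QuotientGroup.mk' (principalIdeles K'))) hN)

/-- **Tate's Lemma (§12), first step: a class field of `K'` whose norm group is `G(K'|K)`-stable is
normal over `K`** ("`M/K` is a Galois extension since `H'` is invariant under `G(L/K)`").
[cite: CasselsFrohlichANT1967, Ch. VII §12, proof of the Lemma (PDF p. 239)] -/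
theorem normal_of_forall_smul_normGroup_eq (hR : artinReciprocity_character)
    (hstab : ∀ σ : K' ≃ₐ[K] K', σ • Automorphic.normGroup K' L = Automorphic.normGroup K' L) :
    Normal K (L.restrictScalars K) := by
  haveI : Algebra.IsAlgebraic K (AlgebraicClosure K') := Algebra.IsAlgebraic.trans K K' (AlgebraicClosure K')
  haveI : Normal K (AlgebraicClosure K') := ⟨fun x => IsAlgClosed.splits _⟩
  rw [IntermediateField.normal_iff_forall_map_le']
  intro ρ x hx
  rw [IntermediateField.mem_map] at hx
  obtain ⟨y, hy, rfl⟩ := hx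
  rw [IntermediateField.mem_restrictScalars] at hy ⊢
  have h := conjField_eq_of_smul_normGroup_eq L hR ρ (hstab _)
  rw [← h]
  exact mem_conjField_iff.mpr ⟨y, hy, rfl⟩

/-- Unconditional form of `normal_of_forall_smul_normGroup_eq` (the reciprocity law being the tree's
theorem `artinReciprocity_character_holds`).
[cite: CasselsFrohlichANT1967, Ch. VII §12, proof of the Lemma (PDF p. 239)] -/
theorem normal_of_forall_smul_normGroup_eq'
    (hstab : ∀ σ : K' ≃ₐ[K] K', σ • Automorphic.normGroup K' L = Automorphic.normGroup K' L) :
    Normal K (L.restrictScalars K) :=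
  normal_of_forall_smul_normGroup_eq L artinReciprocity_character_holds hstab

end ConjField

end Literature.NumberTheory.GaloisRepresentations

end
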